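import Literature.RingTheory.Flat.AmitsurDegreeZero
import Mathlib.RingTheory.Flat.Basic
import Mathlib.RingTheory.TensorProduct.Basic
import Mathlib.RingTheory.IsTensorProduct
import Mathlib.Algebra.Module.Submodule.EqLocus
import HarnessLib

/-!
# Faithfully flat descent for MODULES is EFFECTIVE (affine ∕ Amitsur form, comodule spelling)

Topic `Literature/RingTheory/Flat`, namespace `Literature.RingTheory.Flat.ModuleDescent`.  THEOREMS ONLY; no definition, no named fact,
no instance, no notation, no `sorry`.  The OBJECT half of Grothendieck's faithfully flat descent for quasi-coherent modules on one affine
chart ([SGA1] Exp. VIII Thm. 1.1; [StacksProject, Tag 023N]; [GortzWedhorn2020] Thm. 14.68; [Bosch2013] §4.6 Thm. 5), complementing the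
FULL-FAITHFULNESS half already in the tree (★ `AmitsurDegreeZero`, ★ `AmitsurDescentData`, ★ `AmitsurDegreeOne`, ★ `AmitsurKernelPair`).

## The datum (spelling)
For a ring map `R → S` and an `S`-module `M`, a descent datum is recorded in COMODULE ∕ COACTION form — exactly the form in which
[StacksProject, Tag 023N] uses it (`θ m := φ (m ⊗ 1)` for the `S ⊗_R S`-linear `φ : M ⊗_R S → S ⊗_R M` of [StacksProject, Tag 023G];
comodules of the Sweedler coring `S ⊗_R S`), with the NEW `S`-factor on the LEFT as in ★ `AmitsurDegreeZero` (`TensorProduct.mk R S M 1 = (1 ⊗ –)`,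
`LinearMap.lTensor S`):
* `θ : M →ₗ[S] S ⊗[R] M` (`S` acting on `S ⊗[R] M` through the left factor, Mathlib's `TensorProduct.leftModule`);
* COUNIT `hε : ∀ m, (LinearMap.id).liftBaseChange S (θ m) = m` (`s ⊗ m ↦ s • m` retracts `θ`; «`φ` is the identity on the diagonal»);
* COCYCLE = coassociativity `hδ : ∀ m, (S ⊗ θ) (θ m) = (S ⊗ (1 ⊗ –)) (θ m)` in `S ⊗_R S ⊗_R M` («`φ₀₂ = φ₁₂ ∘ φ₀₁`» on `m ⊗ 1 ⊗ 1`).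
No invertibility hypothesis is needed, and no `S ⊗_R S`-module structure is used.  The DESCENDED MODULE is spelled inline as Mathlib's
`LinearMap.eqLocus (θ.restrictScalars R) (TensorProduct.mk R S M 1) = {m | θ m = 1 ⊗ m}` (an `R`-submodule of `M`; [StacksProject, Tag 023N]'s
`H⁰`), and the COMPARISON `S ⊗_R {m | θ m = 1 ⊗ m} → M`, `s ⊗ n ↦ s • n`, is Mathlib's `(LinearMap.eqLocus …).subtype.liftBaseChange S`.

## Results
* §1 (no flatness) the split equaliser of a comodule: `injective_of_counit`, `apply_liftBaseChange_id_of_lTensor_eq` (`x = θ (μ x)` whenever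
  `(S ⊗ θ) x = (S ⊗ (1 ⊗ –)) x`), `lTensor_apply_eq_iff_mem_range`; and, for the comparison `α`, **`apply_liftBaseChange`** — `θ (α y) = (S ⊗ ι) y`
  (the datum becomes the CANONICAL one, hypothesis-free), `apply_liftBaseChange_eq_lTensor_lTensor` (coalgebra-morphism form).
* §2 (`S` FLAT over `R`) **`liftBaseChange_injective`**, **`liftBaseChange_surjective`**, **`liftBaseChange_bijective`** — EFFECTIVITY
  `S ⊗_R {m | θ m = 1 ⊗ m} ≅ M` ([StacksProject, Tag 023N]; flatness suffices for this half: `S ⊗_R –` preserves the split equaliser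
  `M → S ⊗ M ⇉ S ⊗ S ⊗ M`, Beck), `exists_linearEquiv`, `isBaseChange_subtype` (the ★ `AmitsurDescentData` currency `IsBaseChange S ι`).
* §3 (`S` FAITHFULLY flat) UNIQUENESS: an `R`-module `N′` with an `S`-isomorphism `e : S ⊗_R N′ ≅ M` matching the data is `≃ₗ[R]` the
  descended module via `n ↦ e (1 ⊗ n)` — `apply_one_tmul_mem`, `comp_mk_one_injective`, **`range_comp_mk_one_eq_eqLocus`**,
  **`exists_linearEquiv_eqLocus`** (engine ★ `AmitsurDegreeZero.mem_range_mk_one_iff` ∕ `mk_one_injective`).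
* §4 the CANONICAL datum `(TensorProduct.mk R S N₀ 1).baseChange S` of `S ⊗_R N₀` (`s ⊗ n ↦ s ⊗ 1 ⊗ n`): it is counital and coassociative
  (`liftBaseChange_id_baseChange_mk_one`, `lTensor_baseChange_mk_one`), and for `R → S` faithfully flat its descended module is `(1 ⊗ –)(N₀)`
  (`eqLocus_baseChange_mk_one_eq_range`, ★ `AmitsurDegreeZero` in `eqLocus` dress).

Mathlib has the categorical twin `comonadicExtendScalars` (`Algebra/Category/ModuleCat/Descent`: extension of scalars along a faithfully flat
map is comonadic), but no module-level statement and no name for the descended module; Mathlib `RingTheory/Flat/FaithfullyFlat/Descent` descends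
PROPERTIES only.  The `φ`-form ⇄ `θ`-form dictionary (an `S ⊗ S`-linear isomorphism with the cocycle on `S ⊗ S ⊗ S` gives `hε`, `hδ`, and
conversely, [Bosch2013] §4.6) is not restated here.  Written for cell `hodgecm-mathlib` (P6b wave C, §D `stub_L4B1uD_mumfordLambdaDescent`:
descent of the Mumford bundle along the finite flat torsor quotient `1 × π`, affine-locally this file); HC_CM is proved only modulo the 7
printed citations until rung 0 closes; nothing here is about HC.

## References
* [SGA1] A. Grothendieck, *SGA 1*, Exp. VIII (descente fidèlement plate) Thm. 1.1.
* [StacksProject] The Stacks Project, Tag 023G (Definition 35.3.1, descent datum for modules), Tag 023N (Proposition 35.3.9, descent for modules),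
  Tag 023M (Lemma 35.3.6).
* [GortzWedhorn2020] U. Görtz, T. Wedhorn, *Algebraic Geometry I*, 2nd ed. (2020), Thm. 14.68 (pp. 457–458), Prop. 14.65 (pp. 455–456), Lemma 14.64 (p. 455) and (14.14.2) (p. 454).
* [Bosch2013] S. Bosch, *Algebraic Geometry and Commutative Algebra* (2013), §4.6 Thm. 5 (p. 147).
-/

universe u v w w'

open TensorProduct

namespace Literature.RingTheory.Flat.ModuleDescent

variable (R : Type u) (S : Type v) [CommRing R] [CommRing S] [Algebra R S]

/-! ## §1 The split equaliser of a comodule (no flatness) -/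

section SplitEqualiser

variable {M : Type w} [AddCommGroup M] [Module R M] [Module S M] [IsScalarTower R S M]
variable (θ : M →ₗ[S] S ⊗[R] M)

/-- Membership in the descended module `{m | θ m = 1 ⊗ m}` ([StacksProject, Tag 023N]'s `H⁰`), spelled `LinearMap.eqLocus`.
[cite: StacksProject, Tag 023N] -/
theorem mem_eqLocus_iff (m : M) :
    m ∈ LinearMap.eqLocus (θ.restrictScalars R) (TensorProduct.mk R S M 1) ↔ θ m = 1 ⊗ₜ[R] m :=
  Iff.rfl

omit [Module S M] [IsScalarTower R S M] in
/-- The contraction `c : S ⊗_R (S ⊗_R M) → S ⊗_R M`, `s ⊗ (s′ ⊗ m) ↦ ss′ ⊗ m` of ★ `AmitsurDegreeZero` is `s ⊗ y ↦ s • y`.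
[cite: StacksProject, Tag 023M] -/
theorem contract_tmul_eq_smul (s : S) (y : S ⊗[R] M) :
    ((LinearMap.rTensor M (LinearMap.mul' R S)) ∘ₗ (TensorProduct.assoc R S S M).symm.toLinearMap) (s ⊗ₜ[R] y) = s • y := by
  induction y using TensorProduct.induction_on with
  | zero => simp
  | tmul s' m => simp [TensorProduct.smul_tmul']
  | add x y hx hy => rw [tmul_add, map_add, hx, hy, smul_add]

/-- A COUNITAL datum is injective: `μ ∘ θ = id` with `μ = (id).liftBaseChange S : s ⊗ m ↦ s • m`. [cite: StacksProject, Tag 023N] -/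
theorem injective_of_counit (hε : ∀ m : M, (LinearMap.id : M →ₗ[R] M).liftBaseChange S (θ m) = m) :
    Function.Injective θ := by
  intro m m' h
  rw [← hε m, ← hε m', h]

/-- `c ∘ (S ⊗ θ) = θ ∘ μ`: contracting after `S ⊗ θ` is `θ` after the multiplication `μ : S ⊗_R M → M` — this is the `S`-linearity of `θ`
(on `s ⊗ m`: `s • θ m = θ (s • m)`).  One of the three split-equaliser identities of the comodule `(M, θ)`. [cite: StacksProject, Tag 023N] -/
theorem contract_lTensor_eq_apply_liftBaseChange_id (x : S ⊗[R] M) :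
    ((LinearMap.rTensor M (LinearMap.mul' R S)) ∘ₗ (TensorProduct.assoc R S S M).symm.toLinearMap)
        (LinearMap.lTensor S (θ.restrictScalars R) x) =
      θ ((LinearMap.id : M →ₗ[R] M).liftBaseChange S x) := by
  induction x using TensorProduct.induction_on with
  | zero => simp
  | tmul s m =>
      rw [LinearMap.lTensor_tmul, LinearMap.coe_restrictScalars, contract_tmul_eq_smul, LinearMap.liftBaseChange_tmul,
        LinearMap.id_apply, map_smul]
  | add x y hx hy => rw [map_add, map_add, hx, hy, map_add, map_add]

/-- **Split equaliser, first half**: if `x ∈ S ⊗_R M` has `(S ⊗ θ) x = (S ⊗ (1 ⊗ –)) x` in `S ⊗_R S ⊗_R M`, then `x = θ (μ x)` — contract both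
sides (`c ∘ (S ⊗ (1 ⊗ –)) = id`, ★ `AmitsurDegreeZero.contract_lTensor_mk_one`; `c ∘ (S ⊗ θ) = θ ∘ μ`).  No hypothesis on `θ` beyond
`S`-linearity. [cite: StacksProject, Tag 023N] -/
theorem apply_liftBaseChange_id_of_lTensor_eq (x : S ⊗[R] M)
    (hx : LinearMap.lTensor S (θ.restrictScalars R) x = LinearMap.lTensor S (TensorProduct.mk R S M 1) x) :
    θ ((LinearMap.id : M →ₗ[R] M).liftBaseChange S x) = x := by
  rw [← contract_lTensor_eq_apply_liftBaseChange_id, hx, contract_lTensor_mk_one]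

/-- **Split equaliser**: for a COASSOCIATIVE datum, `x ∈ S ⊗_R M` satisfies `(S ⊗ θ) x = (S ⊗ (1 ⊗ –)) x` iff `x ∈ range θ`
(`M —θ→ S ⊗ M ⇉ S ⊗ S ⊗ M` is an equaliser, split by `μ` and the contraction). [cite: StacksProject, Tag 023N] -/
theorem lTensor_apply_eq_iff_mem_range
    (hδ : ∀ m : M, LinearMap.lTensor S (θ.restrictScalars R) (θ m) = LinearMap.lTensor S (TensorProduct.mk R S M 1) (θ m))
    (x : S ⊗[R] M) :
    LinearMap.lTensor S (θ.restrictScalars R) x = LinearMap.lTensor S (TensorProduct.mk R S M 1) x ↔ x ∈ Set.range θ := by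
  constructor
  · intro hx
    exact ⟨_, apply_liftBaseChange_id_of_lTensor_eq R S θ x hx⟩
  · rintro ⟨m, rfl⟩
    exact hδ m

/-- The comparison `α = ι.liftBaseChange S : S ⊗_R {m | θ m = 1 ⊗ m} → M` factors as `μ ∘ (S ⊗ ι)` (`ι` the inclusion): on `s ⊗ n` both give
`s • n`. [cite: StacksProject, Tag 023N] -/
theorem liftBaseChange_id_lTensor_subtype
    (y : S ⊗[R] LinearMap.eqLocus (θ.restrictScalars R) (TensorProduct.mk R S M 1)) :
    (LinearMap.id : M →ₗ[R] M).liftBaseChange S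
        (LinearMap.lTensor S (LinearMap.eqLocus (θ.restrictScalars R) (TensorProduct.mk R S M 1)).subtype y) =
      (LinearMap.eqLocus (θ.restrictScalars R) (TensorProduct.mk R S M 1)).subtype.liftBaseChange S y := by
  induction y using TensorProduct.induction_on with
  | zero => simp
  | tmul s n => simp
  | add x y hx hy => rw [map_add, map_add, hx, hy, map_add]

/-- The image of `S ⊗ ι : S ⊗_R {m | θ m = 1 ⊗ m} → S ⊗_R M` lies in the equaliser `{x | (S ⊗ θ) x = (S ⊗ (1 ⊗ –)) x}` (on `s ⊗ n`:
`s ⊗ θ n = s ⊗ 1 ⊗ n`).  No hypothesis on `θ`. [cite: StacksProject, Tag 023N] -/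
theorem lTensor_apply_lTensor_subtype
    (y : S ⊗[R] LinearMap.eqLocus (θ.restrictScalars R) (TensorProduct.mk R S M 1)) :
    LinearMap.lTensor S (θ.restrictScalars R)
        (LinearMap.lTensor S (LinearMap.eqLocus (θ.restrictScalars R) (TensorProduct.mk R S M 1)).subtype y) =
      LinearMap.lTensor S (TensorProduct.mk R S M 1)
        (LinearMap.lTensor S (LinearMap.eqLocus (θ.restrictScalars R) (TensorProduct.mk R S M 1)).subtype y) := by
  induction y using TensorProduct.induction_on with
  | zero => simp
  | tmul s n =>
      have hn : θ (n : M) = 1 ⊗ₜ[R] (n : M) := n.2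
      simp [hn]
  | add x y hx hy => rw [map_add, map_add, map_add, hx, hy]

/-- **(E2) Under the comparison the datum is the CANONICAL one**: `θ (α y) = (S ⊗ ι) y` for every `y ∈ S ⊗_R {m | θ m = 1 ⊗ m}`, i.e.
`θ (s • n) = s ⊗ n` — hypothesis-free (only the `S`-linearity of `θ`). [cite: StacksProject, Tag 023N] [cite: GortzWedhorn2020, Thm. 14.68] -/
theorem apply_liftBaseChange
    (y : S ⊗[R] LinearMap.eqLocus (θ.restrictScalars R) (TensorProduct.mk R S M 1)) :
    θ ((LinearMap.eqLocus (θ.restrictScalars R) (TensorProduct.mk R S M 1)).subtype.liftBaseChange S y) =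
      LinearMap.lTensor S (LinearMap.eqLocus (θ.restrictScalars R) (TensorProduct.mk R S M 1)).subtype y := by
  rw [← liftBaseChange_id_lTensor_subtype,
    apply_liftBaseChange_id_of_lTensor_eq R S θ _ (lTensor_apply_lTensor_subtype R S θ y)]

/-- **(E2′) The comparison is a morphism of descent data**: `θ ∘ α = (S ⊗ α) ∘ θ_can` with `θ_can = S ⊗ (1 ⊗ –)` the canonical datum of
`S ⊗_R {m | θ m = 1 ⊗ m}`. [cite: StacksProject, Tag 023N] [cite: GortzWedhorn2020, Thm. 14.68] -/
theorem apply_liftBaseChange_eq_lTensor_lTensor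
    (y : S ⊗[R] LinearMap.eqLocus (θ.restrictScalars R) (TensorProduct.mk R S M 1)) :
    θ ((LinearMap.eqLocus (θ.restrictScalars R) (TensorProduct.mk R S M 1)).subtype.liftBaseChange S y) =
      LinearMap.lTensor S
          (((LinearMap.eqLocus (θ.restrictScalars R) (TensorProduct.mk R S M 1)).subtype.liftBaseChange S).restrictScalars R)
        (LinearMap.lTensor S
          (TensorProduct.mk R S (LinearMap.eqLocus (θ.restrictScalars R) (TensorProduct.mk R S M 1)) 1) y) := by
  rw [apply_liftBaseChange, ← LinearMap.comp_apply, ← LinearMap.lTensor_comp]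
  congr 1
  ext n
  simp

end SplitEqualiser

/-! ## §2 Effectivity (`S` flat over `R`) -/

section Effective

variable {M : Type w} [AddCommGroup M] [Module R M] [Module S M] [IsScalarTower R S M]
variable (θ : M →ₗ[S] S ⊗[R] M)

/-- `0 → {m | θ m = 1 ⊗ m} —ι→ M —(θ − (1 ⊗ –))→ S ⊗_R M` is exact (definition of `eqLocus`). [cite: StacksProject, Tag 023N] -/
theorem exact_subtype_sub :
    Function.Exact (LinearMap.eqLocus (θ.restrictScalars R) (TensorProduct.mk R S M 1)).subtype
      (θ.restrictScalars R - TensorProduct.mk R S M 1) := by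
  intro m
  rw [LinearMap.sub_apply, sub_eq_zero]
  constructor
  · intro hm
    exact ⟨⟨m, hm⟩, rfl⟩
  · rintro ⟨n, rfl⟩
    exact n.2

variable [Module.Flat R S]

/-- **The comparison `S ⊗_R {m | θ m = 1 ⊗ m} → M` is INJECTIVE** for `S` flat over `R` (and `θ` merely `S`-linear): `θ ∘ α = S ⊗ ι`
(`apply_liftBaseChange`) and `S ⊗ ι` is injective by flatness. [cite: StacksProject, Tag 023N] [cite: GortzWedhorn2020, Thm. 14.68] -/
theorem liftBaseChange_injective :
    Function.Injective ((LinearMap.eqLocus (θ.restrictScalars R) (TensorProduct.mk R S M 1)).subtype.liftBaseChange S) := by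
  intro y y' h
  have h' := congrArg θ h
  rw [apply_liftBaseChange, apply_liftBaseChange] at h'
  exact Module.Flat.lTensor_preserves_injective_linearMap _ Subtype.val_injective h'

/-- **The comparison `S ⊗_R {m | θ m = 1 ⊗ m} → M` is SURJECTIVE** for `S` flat over `R` and `θ` counital and coassociative: `θ m` lies in the
equaliser `{x | (S ⊗ θ) x = (S ⊗ (1 ⊗ –)) x} = ker (S ⊗ (θ − (1 ⊗ –))) = range (S ⊗ ι)` (flatness, Mathlib `Module.Flat.lTensor_exact`), and
`α y = μ ((S ⊗ ι) y) = μ (θ m) = m`. [cite: StacksProject, Tag 023N] [cite: GortzWedhorn2020, Thm. 14.68] [cite: SGA1, Exp. VIII Thm. 1.1] -/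
theorem liftBaseChange_surjective
    (hε : ∀ m : M, (LinearMap.id : M →ₗ[R] M).liftBaseChange S (θ m) = m)
    (hδ : ∀ m : M, LinearMap.lTensor S (θ.restrictScalars R) (θ m) = LinearMap.lTensor S (TensorProduct.mk R S M 1) (θ m)) :
    Function.Surjective ((LinearMap.eqLocus (θ.restrictScalars R) (TensorProduct.mk R S M 1)).subtype.liftBaseChange S) := by
  intro m
  have hexact := Module.Flat.lTensor_exact S (exact_subtype_sub R S θ)
  have hm : LinearMap.lTensor S (θ.restrictScalars R - TensorProduct.mk R S M 1) (θ m) = 0 := by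
    rw [LinearMap.lTensor_sub, LinearMap.sub_apply, sub_eq_zero]
    exact hδ m
  obtain ⟨y, hy⟩ := (hexact (θ m)).1 hm
  refine ⟨y, ?_⟩
  rw [← liftBaseChange_id_lTensor_subtype, hy, hε]

/-- **EFFECTIVITY of descent for modules** ([StacksProject, Tag 023N]; [SGA1] VIII Thm. 1.1; [GortzWedhorn2020] Thm. 14.68; [Bosch2013] §4.6
Thm. 5): for `S` flat over `R` and a counital coassociative datum `θ : M → S ⊗_R M`, the comparison `S ⊗_R {m | θ m = 1 ⊗ m} → M`, `s ⊗ n ↦ s • n`,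
is BIJECTIVE.  (Flatness suffices for this half; faithful flatness is needed for uniqueness, §3.) [cite: StacksProject, Tag 023N]
[cite: SGA1, Exp. VIII Thm. 1.1] [cite: GortzWedhorn2020, Thm. 14.68] -/
theorem liftBaseChange_bijective
    (hε : ∀ m : M, (LinearMap.id : M →ₗ[R] M).liftBaseChange S (θ m) = m)
    (hδ : ∀ m : M, LinearMap.lTensor S (θ.restrictScalars R) (θ m) = LinearMap.lTensor S (TensorProduct.mk R S M 1) (θ m)) :
    Function.Bijective ((LinearMap.eqLocus (θ.restrictScalars R) (TensorProduct.mk R S M 1)).subtype.liftBaseChange S) :=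
  ⟨liftBaseChange_injective R S θ, liftBaseChange_surjective R S θ hε hδ⟩

/-- `≃` form of effectivity: an `S`-linear isomorphism `S ⊗_R {m | θ m = 1 ⊗ m} ≃ M` with `s ⊗ n ↦ s • n`. [cite: StacksProject, Tag 023N]
[cite: GortzWedhorn2020, Thm. 14.68] -/
theorem exists_linearEquiv
    (hε : ∀ m : M, (LinearMap.id : M →ₗ[R] M).liftBaseChange S (θ m) = m)
    (hδ : ∀ m : M, LinearMap.lTensor S (θ.restrictScalars R) (θ m) = LinearMap.lTensor S (TensorProduct.mk R S M 1) (θ m)) :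
    ∃ α : S ⊗[R] LinearMap.eqLocus (θ.restrictScalars R) (TensorProduct.mk R S M 1) ≃ₗ[S] M,
      ∀ (s : S) (n : LinearMap.eqLocus (θ.restrictScalars R) (TensorProduct.mk R S M 1)), α (s ⊗ₜ[R] n) = s • (n : M) :=
  ⟨LinearEquiv.ofBijective _ (liftBaseChange_bijective R S θ hε hδ), fun s n => by simp⟩

/-- `IsBaseChange` form of effectivity (the currency of ★ `AmitsurDescentData`): the inclusion `ι : {m | θ m = 1 ⊗ m} → M` exhibits `M` as the
base change `S ⊗_R {m | θ m = 1 ⊗ m}`. [cite: StacksProject, Tag 023N] [cite: GortzWedhorn2020, Thm. 14.68] -/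
theorem isBaseChange_subtype
    (hε : ∀ m : M, (LinearMap.id : M →ₗ[R] M).liftBaseChange S (θ m) = m)
    (hδ : ∀ m : M, LinearMap.lTensor S (θ.restrictScalars R) (θ m) = LinearMap.lTensor S (TensorProduct.mk R S M 1) (θ m)) :
    IsBaseChange S (LinearMap.eqLocus (θ.restrictScalars R) (TensorProduct.mk R S M 1)).subtype :=
  IsBaseChange.of_equiv (LinearEquiv.ofBijective _ (liftBaseChange_bijective R S θ hε hδ)) fun n => by simp

end Effective

/-! ## §3 Uniqueness of the descended module (`S` faithfully flat over `R`) -/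

section Unique

variable {M : Type w} [AddCommGroup M] [Module R M] [Module S M] [IsScalarTower R S M]
variable (θ : M →ₗ[S] S ⊗[R] M)
variable {N' : Type w'} [AddCommGroup N'] [Module R N'] (e : S ⊗[R] N' →ₗ[S] M)

/-- If `e : S ⊗_R N′ → M` carries the canonical datum of `S ⊗_R N′` to `θ` (`θ ∘ e = (S ⊗ e) ∘ (S ⊗ (1 ⊗ –))`), then `e (1 ⊗ n)` lies in the
descended module `{m | θ m = 1 ⊗ m}`.  No hypothesis on `R → S`. [cite: StacksProject, Tag 023N] -/
theorem apply_one_tmul_mem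
    (he : ∀ y, θ (e y) = LinearMap.lTensor S (e.restrictScalars R) (LinearMap.lTensor S (TensorProduct.mk R S N' 1) y))
    (n : N') :
    e (1 ⊗ₜ[R] n) ∈ LinearMap.eqLocus (θ.restrictScalars R) (TensorProduct.mk R S M 1) := by
  rw [mem_eqLocus_iff, he]
  simp

variable [Module.FaithfullyFlat R S]

/-- For `R → S` faithfully flat and `e : S ⊗_R N′ → M` injective, `n ↦ e (1 ⊗ n) : N′ → M` is injective (★ `AmitsurDegreeZero.mk_one_injective`).
[cite: StacksProject, Tag 023M] -/
theorem comp_mk_one_injective (hinj : Function.Injective e) :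
    Function.Injective ((e.restrictScalars R) ∘ₗ TensorProduct.mk R S N' 1) :=
  hinj.comp (mk_one_injective R S N')

/-- **UNIQUENESS of the descended module** ([StacksProject, Tag 023N]; [GortzWedhorn2020] Lemma 14.64 ∕ Thm. 14.68; [Bosch2013] §4.6 Thm. 5):
for `R → S` faithfully flat, if `e : S ⊗_R N′ → M` is a bijection carrying the canonical datum to `θ`, then the descended module `{m | θ m = 1 ⊗ m}`
is exactly `{e (1 ⊗ n) | n ∈ N′}`.  (`⊇` is `apply_one_tmul_mem`; `⊆`: `θ (e x) = 1 ⊗ e x` and `S ⊗ e` injective force `(S ⊗ (1 ⊗ –)) x = (1 ⊗ –) x`,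
whence `x = 1 ⊗ n` by ★ `AmitsurDegreeZero.mem_range_mk_one_iff`.) [cite: StacksProject, Tag 023N] [cite: GortzWedhorn2020, Thm. 14.68] -/
theorem range_comp_mk_one_eq_eqLocus
    (he : ∀ y, θ (e y) = LinearMap.lTensor S (e.restrictScalars R) (LinearMap.lTensor S (TensorProduct.mk R S N' 1) y))
    (hbij : Function.Bijective e) :
    LinearMap.range ((e.restrictScalars R) ∘ₗ TensorProduct.mk R S N' 1) =
      LinearMap.eqLocus (θ.restrictScalars R) (TensorProduct.mk R S M 1) := by
  apply le_antisymm
  · rintro _ ⟨n, rfl⟩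
    exact apply_one_tmul_mem R S θ e he n
  · intro m hm
    obtain ⟨x, rfl⟩ := hbij.2 m
    rw [mem_eqLocus_iff, he] at hm
    have h1 : LinearMap.lTensor S (e.restrictScalars R) (TensorProduct.mk R S (S ⊗[R] N') 1 x) = 1 ⊗ₜ[R] e x := by
      simp
    rw [← h1] at hm
    have hx := Module.Flat.lTensor_preserves_injective_linearMap (M := S) (e.restrictScalars R) hbij.1 hm
    obtain ⟨n, hn⟩ := (mem_range_mk_one_iff R S N' x).2 hx
    exact ⟨n, by simp [← hn]⟩

/-- **`≃` form of uniqueness**: for `R → S` faithfully flat, an `R`-module `N′` with an `S`-bijection `e : S ⊗_R N′ → M` carrying the canonical datum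
to `θ` is `R`-isomorphic to the descended module `{m | θ m = 1 ⊗ m}` by `n ↦ e (1 ⊗ n)`. [cite: StacksProject, Tag 023N] [cite: GortzWedhorn2020, Thm. 14.68] -/
theorem exists_linearEquiv_eqLocus
    (he : ∀ y, θ (e y) = LinearMap.lTensor S (e.restrictScalars R) (LinearMap.lTensor S (TensorProduct.mk R S N' 1) y))
    (hbij : Function.Bijective e) :
    ∃ f : N' ≃ₗ[R] LinearMap.eqLocus (θ.restrictScalars R) (TensorProduct.mk R S M 1),
      ∀ n, (f n : M) = e (1 ⊗ₜ[R] n) := by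
  have hrange := range_comp_mk_one_eq_eqLocus R S θ e he hbij
  refine ⟨LinearEquiv.ofBijective
      (((e.restrictScalars R) ∘ₗ TensorProduct.mk R S N' 1).codRestrict _ (apply_one_tmul_mem R S θ e he)) ⟨?_, ?_⟩, fun n => rfl⟩
  · intro a b h
    exact comp_mk_one_injective R S e hbij.1 (congrArg Subtype.val h)
  · rintro ⟨m, hm⟩
    rw [← hrange] at hm
    obtain ⟨n, hn⟩ := hm
    exact ⟨n, Subtype.ext hn⟩

end Unique

/-! ## §4 The canonical datum of `S ⊗_R N₀` -/

section Canonical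

variable (N₀ : Type w) [AddCommGroup N₀] [Module R N₀]

/-- The canonical datum of `S ⊗_R N₀` is `(1 ⊗ –).baseChange S = S ⊗ (1 ⊗ –)`: `s ⊗ n ↦ s ⊗ 1 ⊗ n`. [cite: StacksProject, Tag 023G]
[cite: GortzWedhorn2020, Thm. 14.68] -/
theorem baseChange_mk_one_apply (y : S ⊗[R] N₀) :
    (TensorProduct.mk R S N₀ 1).baseChange S y = LinearMap.lTensor S (TensorProduct.mk R S N₀ 1) y :=
  rfl

/-- The canonical datum is COUNITAL: `μ (s ⊗ 1 ⊗ n) = s ⊗ n`. [cite: StacksProject, Tag 023G] -/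
theorem liftBaseChange_id_baseChange_mk_one (y : S ⊗[R] N₀) :
    (LinearMap.id : S ⊗[R] N₀ →ₗ[R] S ⊗[R] N₀).liftBaseChange S ((TensorProduct.mk R S N₀ 1).baseChange S y) = y := by
  induction y using TensorProduct.induction_on with
  | zero => simp
  | tmul s n => simp [TensorProduct.smul_tmul']
  | add x y hx hy => rw [map_add, map_add, hx, hy]

/-- The canonical datum is COASSOCIATIVE: both sides send `s ⊗ n` to `s ⊗ 1 ⊗ 1 ⊗ n`. [cite: StacksProject, Tag 023G] -/
theorem lTensor_baseChange_mk_one (y : S ⊗[R] N₀) :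
    LinearMap.lTensor S (((TensorProduct.mk R S N₀ 1).baseChange S).restrictScalars R) ((TensorProduct.mk R S N₀ 1).baseChange S y) =
      LinearMap.lTensor S (TensorProduct.mk R S (S ⊗[R] N₀) 1) ((TensorProduct.mk R S N₀ 1).baseChange S y) := by
  induction y using TensorProduct.induction_on with
  | zero => simp
  | tmul s n => simp
  | add x y hx hy => simp only [map_add, hx, hy]

variable [Module.FaithfullyFlat R S]

/-- For `R → S` FAITHFULLY flat, the descended module of the canonical datum of `S ⊗_R N₀` is `(1 ⊗ –)(N₀) ≅ N₀` — ★ `AmitsurDegreeZero.mem_range_mk_one_iff`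
in `eqLocus` dress (the full-faithfulness half of descent). [cite: StacksProject, Tag 023M] [cite: GortzWedhorn2020, Prop. 14.65] -/
theorem eqLocus_baseChange_mk_one_eq_range :
    LinearMap.eqLocus (((TensorProduct.mk R S N₀ 1).baseChange S).restrictScalars R) (TensorProduct.mk R S (S ⊗[R] N₀) 1) =
      LinearMap.range (TensorProduct.mk R S N₀ 1) := by
  ext x
  rw [LinearMap.mem_eqLocus, LinearMap.mem_range, LinearMap.coe_restrictScalars, baseChange_mk_one_apply]
  exact ((mem_range_mk_one_iff R S N₀ x).symm).trans Set.mem_range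

end Canonical

end Literature.RingTheory.Flat.ModuleDescent
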